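import Mathlib
import Summits.MatrixMultiplication.MatrixMultiplication.Theses.ThinBlockAlpha
import Literature.Computability.AlgebraicComplexity.LaserMethodTypeCount

/-!
# REFUTATION skeleton for crux `RectangularThmB` (stmt-MatrixMultiplication-10597, route ThinBlockAlpha)

The crux ("rectangular Theorem B") is FALSE: the null-offset CKSU chart over `ℤ/9`
(symbols `a = (F, {0}, {1})`, `b = ({0}, ℤ/9 ∖ {0,8}, {0})`, `c = ({0}, {0}, F)`, `o = ({0}, {0}, {1})`,
`F = ℤ/9 ∖ {0,1}`; composition `τ = (7/18, 1/9, 7/18, 1/9)`) is TRAPPED (Farkas functional + jointly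
separating profile partitions `Q₁ = {a,b}|{c,o}`, `Q₂ = {a,o}|{b,c}`, `Q₃ = {a,c}|{b}|{o}`, `b`-tight
labels), so the tree's PROVED hashing/type-count theorem `exists_free_diagonal_jointType_card`
(BCS Thm 15.39 + Salem–Spencer/Behrend + types; penalty `Γ_S = 0`) yields local chart-USPs of size
`2^{n H(Q₃τ) - o(n)}`, `H(Q₃τ) = log₂ 9 - (7/9) log₂ 7`, hence (chart version of CKSU Thm 33 = Thm 37)
STPP families in `(ℤ/9)ⁿ` (exponent `9`) of `L` blocks `⟨7^{7m}, 7^{2m}, 7^{7m}⟩` (`n = 18m`, `a = 2/7`)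
with `L · N² ≥ 9ⁿ · 2^{-o(n)}`: `Inner 9 (2/7) η` fails for every `η > 0`.

Stubs (registered on the item via `workitem stub-add`; each lands as its own Theorems file):
`stub_chartSTPP` (CKSU Thm 37 over `IsSTPP`), `stub_nullChart` (the finite chart facts: per-symbol TPP
and trapping), `stub_nullEntropy` (marginal entropies and zero penalty), `stub_growth` (exponential
beats the subexponential hashing loss). Composition `not_RectangularThmB` by the lead (this file).
-/

set_option linter.dupNamespace false

noncomputable section

open Finset

namespace Summit.MatrixMultiplication.MatrixMultiplication.Theorems

open Literature.Computability.AlgebraicComplexity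
open Summit.MatrixMultiplication.MatrixMultiplication.Theses.ThinBlockAlpha

/-! ## Charts (CKSU 2005 Def. 36) and the chart STPP theorem (CKSU 2005 Thm. 37) -/

/-- Solvability of the one-coordinate STPP relation for the symbol pattern `(x, y, z)` = (symbols of
rows `i, j, k`): some `s ∈ A z, s' ∈ A x, t ∈ B x, t' ∈ B y, u ∈ C y, u' ∈ C z` with
`(s' - s) + (t' - t) + (u' - u) = 0` (the index pattern of the tree's `IsSTPP`). -/
def ChartSolvable {H₀ Γ : Type} [AddCommGroup H₀] (A B C : Γ → Finset H₀) (x y z : Γ) : Prop :=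
  ∃ s ∈ A z, ∃ s' ∈ A x, ∃ t ∈ B x, ∃ t' ∈ B y, ∃ u ∈ C y, ∃ u' ∈ C z,
    (s' - s) + (t' - t) + (u' - u) = 0

/-- The triple product property of one symbol `(A, B, C)` in the STPP form. -/
def SymbolTPP {H₀ : Type} [AddCommGroup H₀] (A B C : Finset H₀) : Prop :=
  ∀ s ∈ A, ∀ s' ∈ A, ∀ t ∈ B, ∀ t' ∈ B, ∀ u ∈ C, ∀ u' ∈ C,
    (s' - s) + (t' - t) + (u' - u) = 0 → s = s' ∧ t = t' ∧ u = u'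

/-- **Local chart-USP** (CKSU 2005 Def. 36 specialised to local form): every ordered triple of rows
with indices not all equal has a coordinate whose symbol pattern is not solvable. -/
def IsLocalChartUSP {H₀ Γ : Type} [AddCommGroup H₀] (A B C : Γ → Finset H₀) {n L : ℕ}
    (row : Fin L → Fin n → Γ) : Prop :=
  ∀ i j k : Fin L, (i ≠ j ∨ j ≠ k) → ∃ c : Fin n, ¬ ChartSolvable A B C (row i c) (row j c) (row k c)

/-- STUB (CKSU 2005 Thm. 37 in the tree's conventions): a local chart-USP over a chart with
per-symbol TPP generates an STPP family of product sets in `H₀ⁿ`. -/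
theorem stub_chartSTPP : ∀ (H₀ Γ : Type) [AddCommGroup H₀] [DecidableEq H₀]
    (A B C : Γ → Finset H₀), (∀ x, SymbolTPP (A x) (B x) (C x)) →
    ∀ (n L : ℕ) (row : Fin L → Fin n → Γ), IsLocalChartUSP A B C row →
      IsSTPP (fun i => Fintype.piFinset fun c => A (row i c))
        (fun i => Fintype.piFinset fun c => B (row i c))
        (fun i => Fintype.piFinset fun c => C (row i c)) := by
  sorry

/-! ## The null-offset chart over `ℤ/9` -/

/-- `F = ℤ/9 ∖ {0, 1}`. -/
def nullF : Finset (ZMod 9) := {2, 3, 4, 5, 6, 7, 8}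
/-- `G = ℤ/9 ∖ {0, 8} = -F`. -/
def nullG : Finset (ZMod 9) := {1, 2, 3, 4, 5, 6, 7}
/-- First legs of the symbols `a, b, c, o` (coded `0, 1, 2, 3`). -/
def nullA : Fin 4 → Finset (ZMod 9) := ![nullF, {0}, {0}, {0}]
/-- Middle legs. -/
def nullB : Fin 4 → Finset (ZMod 9) := ![{0}, nullG, {0}, {0}]
/-- Last legs. -/
def nullC : Fin 4 → Finset (ZMod 9) := ![{1}, {0}, nullF, {1}]
/-- Profile partition `Q₁ = {a,b} | {c,o}`. -/
def prof₁ : Fin 4 → Fin 2 := ![0, 0, 1, 1]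
/-- Profile partition `Q₂ = {a,o} | {b,c}`. -/
def prof₂ : Fin 4 → Fin 2 := ![0, 1, 1, 0]
/-- Profile partition `Q₃ = {a,c} | {b} | {o}` (the `D`-lumping). -/
def prof₃ : Fin 4 → Fin 3 := ![0, 1, 0, 2]
/-- Farkas functional, first slot. -/
def farkas₁ : Fin 4 → ℤ := ![1, 1, 0, 0]
/-- Farkas functional, second slot. -/
def farkas₂ : Fin 4 → ℤ := ![0, 1, 1, 0]
/-- Farkas functional, third slot. -/
def farkas₃ : Fin 4 → ℤ := ![-1, -2, -1, 0]
/-- The support `S` = profiles of the four symbols. -/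
def nullS : Finset (Fin 2 × Fin 2 × Fin 3) := {(0, 0, 0), (0, 1, 1), (1, 1, 0), (1, 0, 2)}
/-- The distribution `τ` transported to `S`. -/
def nullP : Fin 2 × Fin 2 × Fin 3 → ℝ := fun p =>
  if p = (0, 0, 0) then 7 / 18 else if p = (0, 1, 1) then 1 / 9 else
  if p = (1, 1, 0) then 7 / 18 else if p = (1, 0, 2) then 1 / 9 else 0

/-- STUB (finite chart facts): per-symbol TPP, and trapping — a solvable pattern has nonnegative
Farkas value, and value zero only on profile-closed patterns. -/
theorem stub_nullChart :
    (∀ x : Fin 4, ∀ s ∈ nullA x, ∀ s' ∈ nullA x, ∀ t ∈ nullB x, ∀ t' ∈ nullB x, ∀ u ∈ nullC x,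
      ∀ u' ∈ nullC x, (s' - s) + (t' - t) + (u' - u) = 0 → s = s' ∧ t = t' ∧ u = u') ∧
    (∀ x y z : Fin 4, (∃ s ∈ nullA z, ∃ s' ∈ nullA x, ∃ t ∈ nullB x, ∃ t' ∈ nullB y, ∃ u ∈ nullC y,
      ∃ u' ∈ nullC z, (s' - s) + (t' - t) + (u' - u) = 0) →
      0 ≤ farkas₁ x + farkas₂ y + farkas₃ z ∧
      (farkas₁ x + farkas₂ y + farkas₃ z = 0 →
        (prof₁ x, prof₂ y, prof₃ z) ∈ ({(0, 0, 0), (0, 1, 1), (1, 1, 0), (1, 0, 2)} :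
          Finset (Fin 2 × Fin 2 × Fin 3)))) := by
  refine ⟨?_, ?_⟩
  · intro x
    fin_cases x <;> decide
  · intro x y z
    fin_cases x <;> fin_cases y <;> fin_cases z <;> decide

/-- STUB (entropy bookkeeping): the three marginal entropies of `τ` on `S` are at least
`h₀ = log₂ 9 - (7/9) log₂ 7` and the max-entropy penalty of `τ` vanishes. -/
theorem stub_nullEntropy :
    Real.logb 2 9 - 7 / 9 * Real.logb 2 7 ≤ shannonEntropy (marginalDist₁ nullP) ∧
    Real.logb 2 9 - 7 / 9 * Real.logb 2 7 ≤ shannonEntropy (marginalDist₂ nullP) ∧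
    Real.logb 2 9 - 7 / 9 * Real.logb 2 7 ≤ shannonEntropy (marginalDist₃ nullP) ∧
    maxEntropyPenalty nullS nullP ≤ 0 := by
  sorry

/-- STUB (growth): the subexponential hashing loss is beaten by `N^η`. -/
theorem stub_growth : ∀ η : ℝ, 0 < η → ∃ m : ℕ, 1 ≤ m ∧
    (((18 * m : ℕ) : ℝ) + 1) ^ 31 * 96 * Real.exp (4 * Real.sqrt (Real.log 3 + ((18 * m : ℕ) : ℝ) * Real.log 12))
      < ((7 : ℝ) ^ (7 * m)) ^ η := by
  sorry

/-! ## Assembly (lead): from the four stubs to `¬ RectangularThmB` -/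

/-! ### Small finite facts about the chart -/

/-- The symbol with a given profile (inverse of `(prof₁, prof₂, prof₃)` on `nullS`; junk `0` elsewhere). -/
def symOf : Fin 2 × Fin 2 × Fin 3 → Fin 4 := fun p =>
  if p = (0, 1, 1) then 1 else if p = (1, 1, 0) then 2 else if p = (1, 0, 2) then 3 else 0

theorem symOf_prof (x : Fin 4) : symOf (prof₁ x, prof₂ x, prof₃ x) = x := by
  fin_cases x <;> decide

theorem prof_symOf (p : Fin 2 × Fin 2 × Fin 3) (hp : p ∈ nullS) :
    (prof₁ (symOf p), prof₂ (symOf p), prof₃ (symOf p)) = p := by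
  revert p
  decide

theorem prof_mem_nullS (x : Fin 4) : (prof₁ x, prof₂ x, prof₃ x) ∈ nullS := by
  fin_cases x <;> decide

theorem farkas_sum_symbol (x : Fin 4) : farkas₁ x + farkas₂ x + farkas₃ x = 0 := by
  fin_cases x <;> decide

theorem card_nullA (x : Fin 4) : (nullA x).card = if x = 0 then 7 else 1 := by
  fin_cases x <;> decide

theorem card_nullB (x : Fin 4) : (nullB x).card = if x = 1 then 7 else 1 := by
  fin_cases x <;> decide

theorem card_nullC (x : Fin 4) : (nullC x).card = if x = 2 then 7 else 1 := by
  fin_cases x <;> decide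

/-- Regrouping a sum over positions by letters. -/
theorem sum_apply_eq_sum_letterCount {n : ℕ} (f : Fin 4 → ℤ) (u : Fin n → Fin 4) :
    ∑ c, f (u c) = ∑ x, (letterCount u x : ℤ) * f x := by
  have h : ∀ c : Fin n, f (u c) = ∑ x : Fin 4, if u c = x then f x else 0 := by
    intro c
    rw [Finset.sum_ite_eq]
    simp
  simp_rw [h]
  rw [Finset.sum_comm]
  refine Finset.sum_congr rfl fun x _ => ?_
  rw [letterCount_apply, ← Finset.sum_filter, Finset.sum_const, nsmul_eq_mul]

/-- Letter counts of the symbol word read off a profile word supported in `nullS`. -/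
theorem letterCount_symOf {N : ℕ} (w : Fin N → Fin 2 × Fin 2 × Fin 3) (hw : ∀ c, w c ∈ nullS)
    (x : Fin 4) : letterCount (fun c => symOf (w c)) x = letterCount w (prof₁ x, prof₂ x, prof₃ x) := by
  simp only [letterCount_apply]
  congr 1
  ext c
  simp only [Finset.mem_filter, Finset.mem_univ, true_and]
  constructor
  · intro h
    rw [← h, prof_symOf _ (hw c)]
  · intro h
    rw [h, symOf_prof]

/-! ### The count vector, the distribution and the labels fed to the hashing theorem -/

/-- The joint type on `S` for word length `18 m`: `7m, 2m, 7m, 2m` on the profiles of `a, b, c, o`. -/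
def nullQ (m : ℕ) : Fin 2 × Fin 2 × Fin 3 → ℕ := fun p =>
  if p = (0, 0, 0) then 7 * m else if p = (0, 1, 1) then 2 * m else
  if p = (1, 1, 0) then 7 * m else if p = (1, 0, 2) then 2 * m else 0

theorem nullQ_eq_zero_of_not_mem (m : ℕ) (p : Fin 2 × Fin 2 × Fin 3) (hp : p ∉ nullS) :
    nullQ m p = 0 := by
  simp only [nullS, Finset.mem_insert, Finset.mem_singleton, not_or] at hp
  simp only [nullQ, hp.1, hp.2.1, hp.2.2.1, hp.2.2.2, if_false]

theorem sum_nullQ (m : ℕ) : ∑ p, nullQ m p = 18 * m := by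
  rw [← Finset.sum_subset (Finset.subset_univ nullS)
    (fun p _ hp => nullQ_eq_zero_of_not_mem m p hp)]
  simp only [nullS]
  rw [Finset.sum_insert (by decide), Finset.sum_insert (by decide), Finset.sum_insert (by decide),
    Finset.sum_singleton]
  simp only [nullQ]
  simp (config := { decide := true }) only [if_true, if_false]
  ring

theorem nullP_eq_div (m : ℕ) (hm : 1 ≤ m) (p : Fin 2 × Fin 2 × Fin 3) :
    nullP p = (nullQ m p : ℝ) / ((18 * m : ℕ) : ℝ) := by
  have h18 : ((18 * m : ℕ) : ℝ) ≠ 0 := by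
    have : (18 * m : ℕ) ≠ 0 := by omega
    exact_mod_cast this
  rw [eq_div_iff h18]
  simp only [nullP, nullQ]
  split_ifs <;> push_cast <;> ring

/-- Tight labels: `α = (0, 1)` on `Q₁`-classes. -/
def labα : Fin 2 → Fin 1 → ℤ := fun i _ => if i = 0 then 0 else 1
/-- Tight labels: `β = (1, 0)` on `Q₂`-classes. -/
def labβ : Fin 2 → Fin 1 → ℤ := fun j _ => if j = 0 then 1 else 0
/-- Tight labels: `γ = (-1, 0, -2)` on `Q₃`-classes. -/
def labγ : Fin 3 → Fin 1 → ℤ := fun l _ => if l = 0 then -1 else if l = 1 then 0 else -2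

theorem labα_injective : Function.Injective labα := by
  intro i i' h
  have := congrFun h 0
  fin_cases i <;> fin_cases i' <;> simp_all (config := { decide := true })

theorem labβ_injective : Function.Injective labβ := by
  intro i i' h
  have := congrFun h 0
  fin_cases i <;> fin_cases i' <;> simp_all (config := { decide := true })

theorem labγ_injective : Function.Injective labγ := by
  intro i i' h
  have := congrFun h 0
  fin_cases i <;> fin_cases i' <;> simp_all (config := { decide := true })

theorem lab_tight : ∀ s ∈ nullS, ∀ ρ : Fin 1, labα s.1 ρ + labβ s.2.1 ρ + labγ s.2.2 ρ = 0 := by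
  intro s hs ρ
  simp only [labα, labβ, labγ]
  revert s
  decide

/-! ### The exponent of `(ℤ/9)ⁿ` -/

theorem exponent_pi_zmod9_le (n : ℕ) : AddMonoid.exponent (Fin n → ZMod 9) ≤ 9 := by
  apply Nat.le_of_dvd (by norm_num)
  apply AddMonoid.exponent_dvd_of_forall_nsmul_eq_zero
  intro g
  funext j
  show 9 • g j = 0
  rw [nsmul_eq_mul, ZMod.natCast_self, zero_mul]

/-! ### The construction -/

/-- **The thin family.** For `η` and `m ≥ 1` large enough that the hashing loss is below
`(7^{7m})^η` (stub `stub_growth`), there is an STPP family in `(ℤ/9)^{18m}` of `L` blocks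
`⟨7^{7m}, 7^{2m}, 7^{7m}⟩` with `9^{18m} ≤ L · (7^{7m})^{2+η}`. -/
theorem exists_thin_family (η : ℝ) (m : ℕ) (hm : 1 ≤ m)
    (hgrowth : (((18 * m : ℕ) : ℝ) + 1) ^ 31 * 96 *
        Real.exp (4 * Real.sqrt (Real.log 3 + ((18 * m : ℕ) : ℝ) * Real.log 12))
      < ((7 : ℝ) ^ (7 * m)) ^ η) :
    ∃ (L : ℕ) (A B C : Fin L → Finset (Fin (18 * m) → ZMod 9)), IsSTPP A B C ∧
      (∀ i, (A i).card = 7 ^ (7 * m) ∧ (B i).card = 7 ^ (2 * m) ∧ (C i).card = 7 ^ (7 * m)) ∧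
      (9 : ℝ) ^ (18 * m) ≤ (L : ℝ) * ((7 : ℝ) ^ (7 * m)) ^ (2 + η) := by
  classical
  set N : ℕ := 18 * m with hNdef
  have hN : 0 < N := by omega
  -- the hashing theorem
  obtain ⟨Δ, hΔQ, hfree, hsize⟩ := exists_free_diagonal_jointType_card nullS labα labβ labγ
    labα_injective labβ_injective labγ_injective (b := 1)
    (fun i ρ => by simp only [labα]; split_ifs <;> simp)
    (fun j ρ => by simp only [labβ]; split_ifs <;> simp)
    lab_tight hN (nullQ m) (fun s hs => nullQ_eq_zero_of_not_mem m s hs) (sum_nullQ m) nullP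
    (nullP_eq_div m hm)
  -- every coordinate of a member of `Δ` is a profile in `S`
  have hmemS : ∀ δ ∈ Δ, ∀ ρ, labelSeq δ ρ ∈ nullS := by
    intro δ hδ ρ
    have hQ : letterCount (labelSeq δ) = nullQ m := (Finset.mem_filter.1 (hΔQ hδ)).2
    by_contra hρ
    have h0 := nullQ_eq_zero_of_not_mem m _ hρ
    rw [← hQ] at h0
    exact (letterCount_pos_of_apply (labelSeq δ) ρ).ne' h0
  -- enumerate `Δ` and read off the rows
  set L : ℕ := Δ.card with hLdef
  let e : Fin L ≃ {x // x ∈ Δ} := Δ.equivFin.symm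
  let d : Fin L → (Fin N → Fin 2) × (Fin N → Fin 2) × (Fin N → Fin 3) := fun i => (e i).1
  have hd : ∀ i, d i ∈ Δ := fun i => (e i).2
  have hdinj : Function.Injective d := fun i i' h => e.injective (Subtype.ext h)
  let row : Fin L → Fin N → Fin 4 := fun i ρ => symOf (labelSeq (d i) ρ)
  have hprof : ∀ i ρ, (prof₁ (row i ρ), prof₂ (row i ρ), prof₃ (row i ρ)) = labelSeq (d i) ρ :=
    fun i ρ => prof_symOf _ (hmemS _ (hd i) ρ)
  have hprof₁ : ∀ i ρ, prof₁ (row i ρ) = (d i).1 ρ := fun i ρ => congrArg Prod.fst (hprof i ρ)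
  have hprof₂ : ∀ i ρ, prof₂ (row i ρ) = (d i).2.1 ρ := fun i ρ =>
    congrArg (fun p => p.2.1) (hprof i ρ)
  have hprof₃ : ∀ i ρ, prof₃ (row i ρ) = (d i).2.2 ρ := fun i ρ =>
    congrArg (fun p => p.2.2) (hprof i ρ)
  -- all rows have the same type
  have htype : ∀ i x, letterCount (row i) x = nullQ m (prof₁ x, prof₂ x, prof₃ x) := by
    intro i x
    have hQ : letterCount (labelSeq (d i)) = nullQ m := (Finset.mem_filter.1 (hΔQ (hd i))).2
    rw [← hQ]
    exact letterCount_symOf _ (hmemS _ (hd i)) x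
  -- the local chart-USP property
  have hUSP : IsLocalChartUSP nullA nullB nullC row := by
    intro i j k hne
    by_contra hall
    push Not at hall
    -- all coordinates solvable ⇒ all Farkas values zero ⇒ all profiles in S ⇒ freeness
    have hg : ∀ c, 0 ≤ farkas₁ (row i c) + farkas₂ (row j c) + farkas₃ (row k c) ∧
        (farkas₁ (row i c) + farkas₂ (row j c) + farkas₃ (row k c) = 0 →
          (prof₁ (row i c), prof₂ (row j c), prof₃ (row k c)) ∈ nullS) :=
      fun c => stub_nullChart.2 _ _ _ (hall c)
    have hsum : ∑ c, (farkas₁ (row i c) + farkas₂ (row j c) + farkas₃ (row k c)) = 0 := by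
      rw [Finset.sum_add_distrib, Finset.sum_add_distrib, sum_apply_eq_sum_letterCount,
        sum_apply_eq_sum_letterCount, sum_apply_eq_sum_letterCount, ← Finset.sum_add_distrib,
        ← Finset.sum_add_distrib]
      refine Finset.sum_eq_zero fun x _ => ?_
      rw [htype i, htype j, htype k, ← mul_add, ← mul_add, farkas_sum_symbol, mul_zero]
    have hzero : ∀ c, farkas₁ (row i c) + farkas₂ (row j c) + farkas₃ (row k c) = 0 := by
      intro c
      exact (Finset.sum_eq_zero_iff_of_nonneg (fun c _ => (hg c).1)).1 hsum c (Finset.mem_univ c)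
    have hS : ∀ c, ((d i).1 c, (d j).2.1 c, (d k).2.2 c) ∈ nullS := by
      intro c
      rw [← hprof₁, ← hprof₂, ← hprof₃]
      exact (hg c).2 (hzero c)
    obtain ⟨hij, hjk⟩ := hfree (d i) (hd i) (d j) (hd j) (d k) (hd k) hS
    exact hne.elim (fun h => h (hdinj hij)) (fun h => h (hdinj hjk))
  -- the STPP family
  refine ⟨L, fun i => Fintype.piFinset fun c => nullA (row i c),
    fun i => Fintype.piFinset fun c => nullB (row i c),
    fun i => Fintype.piFinset fun c => nullC (row i c),
    stub_chartSTPP _ _ nullA nullB nullC stub_nullChart.1 N L row hUSP, ?_, ?_⟩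
  · -- cardinalities
    intro i
    have e0 : nullQ m (prof₁ 0, prof₂ 0, prof₃ 0) = 7 * m := by
      simp [nullQ, prof₁, prof₂, prof₃]
    have e1 : nullQ m (prof₁ 1, prof₂ 1, prof₃ 1) = 2 * m := by
      simp [nullQ, prof₁, prof₂, prof₃]
    have e2 : nullQ m (prof₁ 2, prof₂ 2, prof₃ 2) = 7 * m := by
      simp [nullQ, prof₁, prof₂, prof₃]
    have cA0 : (nullA 0).card = 7 := by decide
    have cA1 : (nullA 1).card = 1 := by decide
    have cA2 : (nullA 2).card = 1 := by decide
    have cA3 : (nullA 3).card = 1 := by decide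
    have cB0 : (nullB 0).card = 1 := by decide
    have cB1 : (nullB 1).card = 7 := by decide
    have cB2 : (nullB 2).card = 1 := by decide
    have cB3 : (nullB 3).card = 1 := by decide
    have cC0 : (nullC 0).card = 1 := by decide
    have cC1 : (nullC 1).card = 1 := by decide
    have cC2 : (nullC 2).card = 7 := by decide
    have cC3 : (nullC 3).card = 1 := by decide
    refine ⟨?_, ?_, ?_⟩
    · rw [Fintype.card_piFinset, prod_apply_eq_prod_pow_letterCount (fun x => (nullA x).card) (row i),
        Fin.prod_univ_four, cA0, cA1, cA2, cA3, one_pow, one_pow, one_pow, mul_one, mul_one, mul_one,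
        htype i 0, e0]
    · rw [Fintype.card_piFinset, prod_apply_eq_prod_pow_letterCount (fun x => (nullB x).card) (row i),
        Fin.prod_univ_four, cB0, cB1, cB2, cB3, one_pow, one_pow, one_pow, mul_one, mul_one, one_mul,
        htype i 1, e1]
    · rw [Fintype.card_piFinset, prod_apply_eq_prod_pow_letterCount (fun x => (nullC x).card) (row i),
        Fin.prod_univ_four, cC0, cC1, cC2, cC3, one_pow, one_pow, one_pow, mul_one, one_mul, one_mul,
        htype i 2, e2]
  · -- the size bound
    obtain ⟨h1, h2, h3, hpen⟩ := stub_nullEntropy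
    set h₀ : ℝ := Real.logb 2 9 - 7 / 9 * Real.logb 2 7 with hh₀
    set X : ℝ := (((18 * m : ℕ) : ℝ) + 1) ^ 31 * 96 *
        Real.exp (4 * Real.sqrt (Real.log 3 + ((18 * m : ℕ) : ℝ) * Real.log 12)) with hX
    -- clean up the right-hand side of the hashing bound
    have hsize' : (2 : ℝ) ^ ((N : ℝ) * h₀) ≤ (L : ℝ) * X := by
      refine le_trans ?_ (le_trans hsize (le_of_eq ?_))
      · apply Real.rpow_le_rpow_of_exponent_le (by norm_num)
        apply mul_le_mul_of_nonneg_left _ (Nat.cast_nonneg N)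
        have := le_min h1 (le_min h2 h3)
        linarith
      · rw [hX, hNdef]
        simp only [Fintype.card_prod, Fintype.card_fin, max_self, Nat.cast_one, mul_one,
          Nat.cast_ofNat, Nat.cast_mul]
        norm_num
    -- the exact tiling identity `2^{N h₀} · 7^{14m} = 9^{18m}`
    have hident : (2 : ℝ) ^ ((N : ℝ) * h₀) * (7 : ℝ) ^ (14 * m) = (9 : ℝ) ^ (18 * m) := by
      have e : (N : ℝ) * h₀ = Real.logb 2 9 * (18 * m : ℕ) - Real.logb 2 7 * (14 * m : ℕ) := by
        rw [hh₀, hNdef]; push_cast; ring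
      rw [e, Real.rpow_sub two_pos, Real.rpow_mul_natCast (by norm_num : (0:ℝ) ≤ 2),
        Real.rpow_mul_natCast (by norm_num : (0:ℝ) ≤ 2),
        Real.rpow_logb two_pos (by norm_num) (by norm_num),
        Real.rpow_logb two_pos (by norm_num) (by norm_num)]
      exact div_mul_cancel₀ _ (by positivity)
    -- `L > 0`
    have hLpos : (0 : ℝ) < L := by
      have h2pos : (0 : ℝ) < (2 : ℝ) ^ ((N : ℝ) * h₀) := Real.rpow_pos_of_pos two_pos _
      have hXpos : 0 < X := by rw [hX]; positivity
      by_contra hle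
      have hL0 : (L : ℝ) ≤ 0 := le_of_not_gt hle
      nlinarith [hsize']
    -- assemble
    have hsplit : ((7 : ℝ) ^ (7 * m)) ^ (2 + η) = (7 : ℝ) ^ (14 * m) * ((7 : ℝ) ^ (7 * m)) ^ η := by
      rw [Real.rpow_add (by positivity), Real.rpow_two, ← pow_mul]
      ring_nf
    rw [hsplit, ← hident]
    have h7pos : (0 : ℝ) < (7 : ℝ) ^ (14 * m) := by positivity
    calc (2 : ℝ) ^ ((N : ℝ) * h₀) * (7 : ℝ) ^ (14 * m)
        ≤ (L : ℝ) * X * (7 : ℝ) ^ (14 * m) := mul_le_mul_of_nonneg_right hsize' h7pos.le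
      _ ≤ (L : ℝ) * ((7 : ℝ) ^ (7 * m)) ^ η * (7 : ℝ) ^ (14 * m) := by
          apply mul_le_mul_of_nonneg_right _ h7pos.le
          exact mul_le_mul_of_nonneg_left hgrowth.le hLpos.le
      _ = (L : ℝ) * ((7 : ℝ) ^ (14 * m) * ((7 : ℝ) ^ (7 * m)) ^ η) := by ring

/-- **The crux `RectangularThmB` is false.** -/
theorem not_RectangularThmB : ¬ RectangularThmB := by
  intro h
  obtain ⟨η, hη, hI⟩ := h 9 (2 / 7) (by norm_num) (by norm_num)
  obtain ⟨m, hm, hgrowth⟩ := stub_growth η hη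
  obtain ⟨L, A, B, C, hS, hc, hbig⟩ := exists_thin_family η m hm hgrowth
  have key := hI (Fin (18 * m) → ZMod 9) (exponent_pi_zmod9_le _) L (7 ^ (7 * m)) (7 ^ (2 * m))
    A B C hS hc (le_trans (by norm_num : 2 ≤ 7 ^ 1) (Nat.pow_le_pow_right (by norm_num) (by omega))) ?_
  · have hH : (Fintype.card (Fin (18 * m) → ZMod 9) : ℝ) = (9 : ℝ) ^ (18 * m) := by
      rw [Fintype.card_fun, ZMod.card, Fintype.card_fin]; push_cast; ring
    rw [hH] at key
    push_cast at key
    linarith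
  · -- N^{2/7} ≤ M
    push_cast
    rw [← Real.rpow_natCast (7 : ℝ) (7 * m), ← Real.rpow_mul (by norm_num),
      ← Real.rpow_natCast (7 : ℝ) (2 * m)]
    apply le_of_eq
    congr 1
    push_cast
    ring

end Summit.MatrixMultiplication.MatrixMultiplication.Theorems
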